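import Mathlib
import Summits.ResolutionOfSingularities.ResolutionOfSingularities.Theorems.WeightedInvariantLocalWeightedDropTameN4SupportClasses
import Summits.ResolutionOfSingularities.ResolutionOfSingularities.Theorems.WeightedInvariantLocalWeightedDropNCTameBinomialEndGame

/-!
# `WeightedInvariant.LocalWeightedDrop`, residual T″|₄ (skeleton v31/v32): THE CENSUS SPECIMEN `y² + x₀²x₁² + x₂³` IS WON — kernel
# certificate for N4-TAME-CENSUS v1.1 §(iii′) («first start uncovered today»; Newton non-degenerate, hence covered once R6 landed)

Crux item stmt-ResolutionOfSingularities-8899 `LocalWeightedDrop` (route `ResolutionOfSingularities/WeightedInvariant`).  [OURS · L1 W4.3, chain w43,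
res-L1-w43-stub-3 (gen 4); bookkeeping over landed pieces: F-D `TameN4.won_four_doublePoint_newtonNonDegenerate` (this seat, rev 3 of
`…TameN4SupportClasses`, over res-L1-w43-stub-1's relative lift `TameN4.preparedWon_of_winsIn` p523892), R6 `NCTransport.totRungNonDegenerate`
(res-D-pv-006 / res-type-088 / res-L1-w43-strat-1, `…NCToricRungClosed`) and res-D-pv-036's Euler certificate
`NCTransport.newtonNonDegenerate_binomial` (`…NCTameBinomialEndGame`).  Nothing here is a statement of H. Hironaka's manuscript; the game is
the programme's own; AI-written, gate-accepted means sorry-free with standard axioms, not refereed.  Definition-free.]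

* `specimenA` — the germ `x₀²x₁² + x₂³ ∈ k⟦x₀,x₁,x₂⟧` (spelled as the binomial position `1·x^(2,2,0) + 1·x^(0,0,3)` of pv-036's end game);
  `specimenA_ne_zero`, `two_le_order_specimenA`, `newtonNonDegenerate_specimenA` (separating slot `x₀`: `(2 : k) ≠ 0`).
* **`won_four_census_specimen_iii`** — `CobordantGame.Won k 4 (y² + x₀²x₁² + x₂³)` for every algebraically closed `k` of characteristic
  `p ≠ 2` (the quartic `y² + x₀²x₁² + …` is singular along the two lines `x₀ = x₂ = y = 0`, `x₁ = x₂ = y = 0`: not a cylinder, not a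
  product in disjoint letters, not an arrangement — the census's first start outside classes (U)(V); won by ONE weighted-game strategy
  assembled from R6 on the support and the relative tame-multiplicity lift).
-/

set_option linter.dupNamespace false -- mandated namespace of this single-conjunct summit
set_option autoImplicit false

namespace Summit.ResolutionOfSingularities.ResolutionOfSingularities.Theorems

namespace TameN4

open Literature.AlgebraicGeometry.Resolution
open Literature.AlgebraicGeometry.Resolution.CobordantGame
open MvPowerSeries TameFourTupleDrop NCTransport

variable {k : Type} [Field k]

/-- The census specimen's support germ `x₀²x₁² + x₂³`, in the binomial spelling `1·x^(2,2,0) + 1·x^(0,0,3)`, equals the displayed polynomial. -/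
theorem specimenA_eq :
    ((1 : MvPowerSeries (Fin 3) k) * monomial (Finsupp.single (0 : Fin 3) 2 + Finsupp.single 1 2) 1 +
        1 * monomial (Finsupp.single (2 : Fin 3) 3) 1) =
      X 0 ^ 2 * X 1 ^ 2 + X 2 ^ 3 := by
  rw [one_mul, one_mul, X_pow_eq, X_pow_eq, X_pow_eq, monomial_mul_monomial, one_mul]

/-- `x₀²x₁² + x₂³ ≠ 0`. -/
theorem specimenA_ne_zero :
    ((1 : MvPowerSeries (Fin 3) k) * monomial (Finsupp.single (0 : Fin 3) 2 + Finsupp.single 1 2) 1 +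
        1 * monomial (Finsupp.single (2 : Fin 3) 3) 1) ≠ 0 := by
  classical
  intro h
  have hc := congrArg (coeff (Finsupp.single (2 : Fin 3) 3)) h
  rw [coeff_binomial, if_neg, if_pos le_rfl, tsub_self, coeff_zero_eq_constantCoeff_apply, map_one, map_zero, zero_add] at hc
  · exact one_ne_zero hc
  · intro hle
    have := hle 0
    simp at this

/-- `ord (x₀²x₁² + x₂³) ≥ 2` (indeed `= 3`). -/
theorem two_le_order_specimenA :
    (2 : ℕ∞) ≤ ((1 : MvPowerSeries (Fin 3) k) * monomial (Finsupp.single (0 : Fin 3) 2 + Finsupp.single 1 2) 1 +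
        1 * monomial (Finsupp.single (2 : Fin 3) 3) 1).order := by
  classical
  refine MvPowerSeries.le_order fun d hd => ?_
  have hdeg : Finsupp.degree d < 2 := by exact_mod_cast hd
  rw [coeff_binomial, if_neg, if_neg, add_zero]
  · intro hle
    have h2 : (3 : ℕ) ≤ d 2 := by simpa using hle 2
    have h3 : d 2 ≤ Finsupp.degree d := Finsupp.le_degree (2 : Fin 3) d
    omega
  · intro hle
    have h0 : (2 : ℕ) ≤ d 0 := by simpa using hle 0
    have h3 : d 0 ≤ Finsupp.degree d := Finsupp.le_degree (0 : Fin 3) d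
    omega

/-- `x₀²x₁² + x₂³` IS NEWTON NON-DEGENERATE in characteristic `≠ 2` (incomparable exponents; separating slot `x₀`: `2 ≠ 0` in `k`) —
res-D-pv-036's Euler certificate `newtonNonDegenerate_binomial`. -/
theorem newtonNonDegenerate_specimenA (h2 : (2 : k) ≠ 0) :
    NewtonNonDegenerate ((1 : MvPowerSeries (Fin 3) k) * monomial (Finsupp.single (0 : Fin 3) 2 + Finsupp.single 1 2) 1 +
        1 * monomial (Finsupp.single (2 : Fin 3) 3) 1) := by
  refine newtonNonDegenerate_binomial (by rw [map_one]; exact one_ne_zero) (by rw [map_one]; exact one_ne_zero) ?_ ?_ ⟨0, ?_⟩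
  · intro hle
    have := hle 0
    simp at this
  · intro hle
    have := hle 2
    simp at this
  · simpa using h2

/-- **THE CENSUS SPECIMEN `y² + x₀²x₁² + x₂³` IS WON IN FOUR VARIABLES** (every algebraically closed `k` of characteristic `p ≠ 2`):
`CobordantGame.Won k 4 (y² + x₀²x₁² + x₂³)`, `y = X 3` — N4-TAME-CENSUS v1.1 §(iii′)'s «first start uncovered today», covered by R6 + the
relative lift exactly as the census predicted. [OURS · L1 W4.3] -/
theorem won_four_census_specimen_iii (p : ℕ) (hp : p.Prime) (k : Type) [Field k] [CharP k p] [IsAlgClosed k] (h2 : (2 : k) ≠ 0) :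
    Won k 4 (X (Fin.last 3) ^ 2 + rename (Fin.succAboveEmb (Fin.last 3)) (X 0 ^ 2 * X 1 ^ 2 + X 2 ^ 3 : MvPowerSeries (Fin 3) k)) := by
  rw [← specimenA_eq]
  exact won_four_doublePoint_newtonNonDegenerate p hp k h2 _ specimenA_ne_zero two_le_order_specimenA (newtonNonDegenerate_specimenA h2)

end TameN4

end Summit.ResolutionOfSingularities.ResolutionOfSingularities.Theorems
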